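import Summits.CriticalPhenomena.PercolationContinuityZ3.Theorems.PercNearOneGluingNoHeavyLowerTailCSHPsiPreMargin
import Summits.CriticalPhenomena.PercolationContinuityZ3.Theorems.PercNearOneGluingNoHeavyLowerTailKNConj4OfCSH
import HarnessLib

/-!
# The EVENT-REFINED Conjecture 4 / Question 7 / (41) of Kozma–Nitzan (all relay sets, all increasing cluster events) from the
# pinned hierarchy

Support file (`--supports stmt-CriticalPhenomena-4575`), route task `nh-dp-fatminority` (line fat-minority-linear, gen 15).
Memo `run/shared/lean/prim/prim-nh-dp-fatminority/CSH-PSI-MEMO.md` §4.  No definitions, no named facts, no sorries.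

THE LINE'S STATEMENT (memo (41)_E; FINDINGS-fat-minority-gen13.md §5).  `G` finite with non-degenerate weights, `o`, `A ∌ o`,
`E = {C_o ∈ 𝓗}` an increasing event of the open edge cluster of `o` (`𝓗` an upper family of edge sets), `F` a monotone functional
of vertex clusters, `c ∈ A` with `E F(C c) ≤ E F(C a)` for all `a ∈ A`.  CLAIM: `∫_{E ∩ {o↔A}} F(C c) ≤ ∫_{E ∩ {o↔A}} F(C o)`.
For `F = 1{b ∈ ·}`: `μ(c ↔ b, E, o ↔ A) ≤ μ(o ↔ b, E, o ↔ A)` — Question 7 / (41) conditioned on `E`; for `o` a star with ports `A`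
and `𝓗` generated by a pattern up-set of the star edges this is the line's UT4 / QUT4-at-`δ ≤ 0` for EVERY number of ports
(THEOREMS A–C of gens 8–11 were `|A| ≤ 3` and the RT4 corner), and with spectator edges QS.  `𝓗 = univ` is the tree's
`PreFKGSurplus.kn_conj4_of_csh` / `Q7Psi.kn_question7`.

* `PinCSH.twoObserver_of_pin` — the two-observer inequality (II)_𝓗 (`= PinCSH.preMargin_nonneg_of_pin` at `D = []`, denominator
  cleared): `μ({k↮X'} ∩ {k↔o} ∩ {C_k ∈ 𝓗}) · Δ_k(X') ≤ μ(k↮X') · Δ^E_o(X')`.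
* `PinCSH.refined_margin_nonneg_of_pin`, `PinCSH.conj4_refined_of_pin`, `PinCSH.question7_refined_of_pin` — the claim, by the
  gen-13 assembly (`RefinedPreFKG.refined_margin_nonneg_of_twoObserver`, there for vertex-set events): peel `k ≠ c`, tower along
  `σ(C_k)`, vdBHK positive association for `C_k` given `k ↮ A∖k` with the monotone indicator of `PinCSH.pinEv o 𝓗 k`, and (II)_𝓗.
HYPOTHESIS `hPin`: the pinned hierarchy `PinCSH.Holds` for the label `o`, every second observer and all owner / avoided-set / decoy
data with distinct named vertices (memo Theorem 1_ψ: paper proof = the cell's proof of `CSH.cshHolds` with the vertex test `1{o ∈ C_z}`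
replaced by the pinned test, whose only used property is exclusivity `PinCSH.reachable_of_mem_pinEv`; exact enumeration 0 / 6,765
systems with the margin minimised over ALL monotone `f`, unfolding identity exact; `𝓗 = univ` is `CSH.cshAll` by `PinCSH.holds_univ_iff`).
[cite: KozmaNitzan2024, Conj. 4 (p. 32), Question 7 (p. 36), (41) (p. 33)] [cite: VandenbergHaggstromKahn2005, Thm. 1.3 (p. 6), §2.1 Lemma 2.4 (p. 10)]
-/

noncomputable section

namespace Summit.CriticalPhenomena.PercolationContinuityZ3.Theorems

open MeasureTheory Set Literature.Probability.LatticeModels Literature.Probability.Percolation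
open scoped Classical
open KNPreFKG CSH PreFKGSurplus

namespace PinCSH

variable {n : ℕ}

/-- **(II)_𝓗 — the event-refined two-observer margin, from the pinned hierarchy** (`preMargin_nonneg_of_pin` at `D = []`, cleared of
its denominator `μ(k ↮ X') > 0`): for `o ≠ k` outside `X'`, `c ∈ X'` of least mean over `X' ∪ {k}`,
`μ({k↮X'} ∩ {k↔o} ∩ {C_k ∈ 𝓗}) · ∫_{k↔X'} (F(C k) − F(C c)) ≤ μ(k↮X') · ∫_{{C_o ∈ 𝓗} ∩ {o↔X'}} (F(C o) − F(C c))`.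
[cite: KozmaNitzan2024, Conj. 4 (p. 32)] -/
theorem twoObserver_of_pin (w : Sym2 (Fin n) → unitInterval) (hw : ∀ e, 0 < w e ∧ w e < 1) (o : Fin n)
    (𝓗 : Set (Set (Sym2 (Fin n))))
    (hPin : ∀ (v x : Fin n) (Y : Finset (Fin n)) (D : List (Fin n)),
      o ≠ v → x ∉ Y → o ≠ x → v ≠ x → o ∉ Y → v ∉ Y → D.Nodup → (∀ d ∈ D, d ≠ x ∧ d ∉ Y ∧ d ≠ o ∧ d ≠ v) →
      Holds w o 𝓗 x (↑Y : Set (Fin n)) D v)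
    (F : Set (Fin n) → ℝ) (hF : ∀ S T : Set (Fin n), S ⊆ T → F S ≤ F T)
    (k c : Fin n) (X' : Finset (Fin n)) (hok : o ≠ k) (hoX' : o ∉ X') (hkX' : k ∉ X') (hcX' : c ∈ X')
    (hcmin : ∀ a ∈ X', ∫ ω, F (openCluster ω c) ∂(prodBernoulli w) ≤ ∫ ω, F (openCluster ω a) ∂(prodBernoulli w)) :
    (prodBernoulli w).real
        (({ω : BondConfig (Fin n) | ∀ a ∈ (↑X' : Set (Fin n)), ¬ (openGraph ω).Reachable k a} ∩ openConn k o) ∩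
          {ω : BondConfig (Fin n) | openEdgeCluster ω k ∈ 𝓗}) *
        (∫ ω in ⋃ a ∈ X', openConn k a, (F (openCluster ω k) - F (openCluster ω c)) ∂(prodBernoulli w)) ≤
      (prodBernoulli w).real {ω : BondConfig (Fin n) | ∀ a ∈ (↑X' : Set (Fin n)), ¬ (openGraph ω).Reachable k a} *
        ∫ ω in {ω : BondConfig (Fin n) | openEdgeCluster ω o ∈ 𝓗} ∩ ⋃ a ∈ X', openConn o a,
          (F (openCluster ω o) - F (openCluster ω c)) ∂(prodBernoulli w) := by
  classical
  set μ := prodBernoulli w with hμ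
  set Dk : Set (BondConfig (Fin n)) := {ω : BondConfig (Fin n) | ∀ a ∈ (↑X' : Set (Fin n)), ¬ (openGraph ω).Reachable k a}
    with hDk
  have h := preMargin_nonneg_of_pin w hw o k 𝓗 (fun x Y D h1 h2 h3 h4 h5 h6 h7 => hPin k x Y D hok h1 h2 h3 h4 h5 h6 h7)
    X' c [] F hF hcX' hcmin hoX' hkX' List.nodup_nil (fun d hd => by simp at hd)
  simp only [pDecoyList, cshMarg_nil, if_true, if_neg hok.symm, List.not_mem_nil, setOf_false, union_empty] at h
  -- `h : 0 ≤ Δ^E_o − p · Δ_k`, `p = μ(Dk ∩ pinEv o 𝓗 k) / μ(Dk)`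
  set Δo : ℝ := ∫ ω in {ω : BondConfig (Fin n) | openEdgeCluster ω o ∈ 𝓗} ∩ ⋃ a ∈ X', openConn o a,
    (F (openCluster ω o) - F (openCluster ω c)) ∂μ with hΔo
  set Δk : ℝ := ∫ ω in ⋃ a ∈ X', openConn k a, (F (openCluster ω k) - F (openCluster ω c)) ∂μ with hΔk
  have hempty_Dk : (∅ : BondConfig (Fin n)) ∈ Dk := by
    intro a ha h'
    rw [HullPort.reachable_empty_iff] at h'
    exact hkX' (h' ▸ (Finset.mem_coe.1 ha))
  have hDkpos : 0 < μ.real Dk := prodBernoulli_real_pos_of_nonempty hw ⟨∅, hempty_Dk⟩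
  have hset : (Dk ∩ openConn k o) ∩ {ω : BondConfig (Fin n) | openEdgeCluster ω k ∈ 𝓗} = Dk ∩ pinEv o 𝓗 k := by
    rw [inter_assoc]; rfl
  rw [hset]
  have hp : pObsConst w o 𝓗 k (↑X' : Set (Fin n)) = μ.real (Dk ∩ pinEv o 𝓗 k) / μ.real Dk := rfl
  rw [hp] at h
  have key : μ.real (Dk ∩ pinEv o 𝓗 k) * Δk = μ.real Dk * (μ.real (Dk ∩ pinEv o 𝓗 k) / μ.real Dk * Δk) := by
    rw [← mul_assoc, mul_div_cancel₀ _ (ne_of_gt hDkpos)]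
  rw [key]
  exact mul_le_mul_of_nonneg_left (by linarith) hDkpos.le

/-- **The event-refined pre-FKG margin is nonnegative, from the pinned hierarchy** (memo Theorem (41)_E, margin form): `𝓗` an upper
family of edge sets, `F` monotone, `o ∉ A`, `c ∈ A` of least mean ⟹ `0 ≤ ∫_{{C_o ∈ 𝓗} ∩ {o↔A}} (F(C o) − F(C c))`.  Proof = the gen-13
assembly with edge-cluster events: peel `k ≠ c`, tower along `σ(C_k)` (`CovTau.setIntegral_sub_eq_projFun`), vdBHK positive association
for `C_k` given `k ↮ A∖k` with the monotone indicator of `pinEv o 𝓗 k`, and `twoObserver_of_pin`.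
[cite: KozmaNitzan2024, Conj. 4 (p. 32)] [cite: VandenbergHaggstromKahn2005, Thm. 1.3 (p. 6), §2.1 Lemma 2.4 (p. 10)] -/
theorem refined_margin_nonneg_of_pin (w : Sym2 (Fin n) → unitInterval) (hw : ∀ e, 0 < w e ∧ w e < 1) (o : Fin n)
    (𝓗 : Set (Set (Sym2 (Fin n)))) (h𝓗 : IsUpperSet 𝓗)
    (hPin : ∀ (v x : Fin n) (Y : Finset (Fin n)) (D : List (Fin n)),
      o ≠ v → x ∉ Y → o ≠ x → v ≠ x → o ∉ Y → v ∉ Y → D.Nodup → (∀ d ∈ D, d ≠ x ∧ d ∉ Y ∧ d ≠ o ∧ d ≠ v) →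
      Holds w o 𝓗 x (↑Y : Set (Fin n)) D v)
    (F : Set (Fin n) → ℝ) (hF : ∀ S T : Set (Fin n), S ⊆ T → F S ≤ F T)
    (A : Finset (Fin n)) (c : Fin n) (hoA : o ∉ A) (hcA : c ∈ A)
    (hcmin : ∀ a ∈ A, ∫ ω, F (openCluster ω c) ∂(prodBernoulli w) ≤ ∫ ω, F (openCluster ω a) ∂(prodBernoulli w)) :
    0 ≤ ∫ ω in {ω : BondConfig (Fin n) | openEdgeCluster ω o ∈ 𝓗} ∩ ⋃ a' ∈ A, openConn o a',
        (F (openCluster ω o) - F (openCluster ω c)) ∂(prodBernoulli w) := by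
  classical
  set μ := prodBernoulli w with hμ
  have hmeas : ∀ S : Set (BondConfig (Fin n)), MeasurableSet S := fun _ => MeasurableSet.of_discrete
  have hint : ∀ (g : BondConfig (Fin n) → ℝ), Integrable g μ := fun g => Integrable.of_finite
  set Ho : Set (BondConfig (Fin n)) := {ω : BondConfig (Fin n) | openEdgeCluster ω o ∈ 𝓗} with hHo
  have main : ∀ (X : Finset (Fin n)), X ⊆ A → c ∈ X →
      0 ≤ ∫ ω in Ho ∩ ⋃ a' ∈ X, openConn o a', (F (openCluster ω o) - F (openCluster ω c)) ∂μ := by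
    intro X hXA hcX
    have hoX : o ∉ X := fun h => hoA (hXA h)
    rcases (X.erase c).eq_empty_or_nonempty with h0 | hne
    · have hXc : X = {c} := by rw [← Finset.insert_erase hcX, h0]; rfl
      rw [hXc]
      have hU : (⋃ a ∈ ({c} : Finset (Fin n)), (openConn o a : Set (BondConfig (Fin n)))) = openConn o c := by ext ω; simp
      rw [hU, setIntegral_congr_fun (hmeas _) (g := fun _ => (0 : ℝ)) (fun ω hω => by
        show F (openCluster ω o) - F (openCluster ω c) = 0
        rw [openCluster_eq_of_reach (show (openGraph ω).Reachable o c from hω.2), sub_self])]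
      simp
    obtain ⟨k, hk⟩ := hne
    have hkc : k ≠ c := (Finset.mem_erase.1 hk).1
    have hkX : k ∈ X := (Finset.mem_erase.1 hk).2
    set X' : Finset (Fin n) := X.erase k with hX'
    have hX'X : ∀ a ∈ X', a ∈ X := fun a ha => Finset.mem_of_mem_erase ha
    have hkX' : k ∉ X' := Finset.notMem_erase k X
    have hcX' : c ∈ X' := Finset.mem_erase.2 ⟨hkc.symm, hcX⟩
    have hko : o ≠ k := fun h => hoX (h ▸ hkX)
    have hoX' : o ∉ X' := fun h => hoX (hX'X o h)
    have hmk : ∫ ω, F (openCluster ω c) ∂μ ≤ ∫ ω, F (openCluster ω k) ∂μ := hcmin k (hXA hkX)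
    set Dk : Set (BondConfig (Fin n)) := {ω : BondConfig (Fin n) | ∀ a ∈ (↑X' : Set (Fin n)), ¬ (openGraph ω).Reachable k a}
      with hDk
    set Hk : Set (BondConfig (Fin n)) := {ω : BondConfig (Fin n) | openEdgeCluster ω k ∈ 𝓗} with hHk
    set gk : BondConfig (Fin n) → ℝ := fun ω => F (openCluster ω k) - F (openCluster ω c) with hgk
    set Gk : Set (Sym2 (Fin n)) → ℝ := fun K => F {z | z = k ∨ ∃ e ∈ K, z ∈ e} -
      ∫ η, F (openCluster (η \ BHK2006.barOf {k} K) c) ∂μ with hGk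
    have hGk_mono : Monotone Gk := CovTau.monotone_projFun w c k F hF
    set Δo : ℝ := ∫ ω in Ho ∩ ⋃ a' ∈ X', openConn o a', (F (openCluster ω o) - F (openCluster ω c)) ∂μ with hΔo
    set Δk : ℝ := ∫ ω in ⋃ a' ∈ X', openConn k a', (F (openCluster ω k) - F (openCluster ω c)) ∂μ with hΔk
    set Tko : ℝ := ∫ ω in (Dk ∩ openConn k o) ∩ Hk, gk ω ∂μ with hTko
    set J : ℝ := ∫ ω in Dk, gk ω ∂μ with hJ
    set M : ℝ := μ.real Dk with hM
    set E : ℝ := μ.real ((Dk ∩ openConn k o) ∩ Hk) with hE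
    -- peel under the event (on the peeled piece `C_o = C_k`, so `Ho` is read as `Hk`)
    have hpeel : ∫ ω in Ho ∩ ⋃ a' ∈ X, openConn o a', (F (openCluster ω o) - F (openCluster ω c)) ∂μ = Δo + Tko := by
      have hpt : ∀ ω : BondConfig (Fin n), (Ho ∩ ⋃ a ∈ X, (openConn o a : Set (BondConfig (Fin n)))).indicator
          (fun ω => F (openCluster ω o) - F (openCluster ω c)) ω =
          (Ho ∩ ⋃ a ∈ X', (openConn o a : Set (BondConfig (Fin n)))).indicator (fun ω => F (openCluster ω o) - F (openCluster ω c)) ω +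
            ((Dk ∩ openConn k o) ∩ Hk).indicator gk ω := by
        intro ω
        by_cases hEv : ω ∈ Ho
        · by_cases h1 : ∃ a ∈ X', (openGraph ω).Reachable o a
          · obtain ⟨a, ha, hoa⟩ := h1
            have m1 : ω ∈ Ho ∩ ⋃ a ∈ X, (openConn o a : Set (BondConfig (Fin n))) :=
              ⟨hEv, (mem_iUnion_openConn X o ω).2 ⟨a, Finset.mem_of_mem_erase ha, hoa⟩⟩
            have m2 : ω ∈ Ho ∩ ⋃ a ∈ X', (openConn o a : Set (BondConfig (Fin n))) :=
              ⟨hEv, (mem_iUnion_openConn _ o ω).2 ⟨a, ha, hoa⟩⟩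
            have m3 : ω ∉ (Dk ∩ openConn k o) ∩ Hk := fun h =>
              h.1.1 a (Finset.mem_coe.2 ha) ((show (openGraph ω).Reachable k o from h.1.2).trans hoa)
            rw [indicator_of_mem m1, indicator_of_mem m2, indicator_of_notMem m3, add_zero]
          · by_cases h2 : (openGraph ω).Reachable o k
            · have m1 : ω ∈ Ho ∩ ⋃ a ∈ X, (openConn o a : Set (BondConfig (Fin n))) :=
                ⟨hEv, (mem_iUnion_openConn X o ω).2 ⟨k, hkX, h2⟩⟩
              have m2 : ω ∉ Ho ∩ ⋃ a ∈ X', (openConn o a : Set (BondConfig (Fin n))) := fun h =>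
                h1 ((mem_iUnion_openConn _ o ω).1 h.2)
              have m3 : ω ∈ (Dk ∩ openConn k o) ∩ Hk := by
                refine ⟨⟨fun a ha hka => h1 ⟨a, Finset.mem_coe.1 ha, h2.trans hka⟩, h2.symm⟩, ?_⟩
                show openEdgeCluster ω k ∈ 𝓗
                rw [attachSet_openEdgeCluster_eq_of_reachable h2.symm]; exact hEv
              rw [indicator_of_mem m1, indicator_of_notMem m2, indicator_of_mem m3, zero_add, hgk]
              simp only
              rw [openCluster_eq_of_reach h2]
            · have m1 : ω ∉ Ho ∩ ⋃ a ∈ X, (openConn o a : Set (BondConfig (Fin n))) := by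
                intro h
                obtain ⟨a, ha, hoa⟩ := (mem_iUnion_openConn X o ω).1 h.2
                by_cases hak : a = k
                · exact h2 (hak ▸ hoa)
                · exact h1 ⟨a, Finset.mem_erase.2 ⟨hak, ha⟩, hoa⟩
              have m2 : ω ∉ Ho ∩ ⋃ a ∈ X', (openConn o a : Set (BondConfig (Fin n))) := fun h =>
                h1 ((mem_iUnion_openConn _ o ω).1 h.2)
              have m3 : ω ∉ (Dk ∩ openConn k o) ∩ Hk := fun h => h2 (show (openGraph ω).Reachable k o from h.1.2).symm
              rw [indicator_of_notMem m1, indicator_of_notMem m2, indicator_of_notMem m3, add_zero]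
        · have m1 : ω ∉ Ho ∩ ⋃ a ∈ X, (openConn o a : Set (BondConfig (Fin n))) := fun h => hEv h.1
          have m2 : ω ∉ Ho ∩ ⋃ a ∈ X', (openConn o a : Set (BondConfig (Fin n))) := fun h => hEv h.1
          have m3 : ω ∉ (Dk ∩ openConn k o) ∩ Hk := by
            intro h
            have : openEdgeCluster ω k = openEdgeCluster ω o :=
              attachSet_openEdgeCluster_eq_of_reachable (show (openGraph ω).Reachable k o from h.1.2)
            exact hEv (by show openEdgeCluster ω o ∈ 𝓗; rw [← this]; exact h.2)
          rw [indicator_of_notMem m1, indicator_of_notMem m2, indicator_of_notMem m3, add_zero]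
      rw [hΔo, hTko, ← integral_indicator (hmeas _), ← integral_indicator (hmeas _), ← integral_indicator (hmeas _),
        ← integral_add (hint _) (hint _)]
      exact integral_congr_ae (Filter.Eventually.of_forall hpt)
    -- the tower identities
    have hDk_S : (Dk ∩ openConn k o) ∩ Hk =
        {ω : BondConfig (Fin n) | ¬ (openGraph ω).Reachable k c} ∩
          {ω | openEdgeCluster ω k ∈ {K : Set (Sym2 (Fin n)) |
            (∀ a ∈ X', a ≠ c → ¬ (a = k ∨ ∃ e ∈ K, a ∈ e)) ∧ (o = k ∨ ∃ e ∈ K, o ∈ e) ∧ K ∈ 𝓗}} := by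
      ext ω
      simp only [mem_inter_iff, hDk, hHk, mem_setOf_eq, Finset.mem_coe]
      constructor
      · rintro ⟨⟨h1, h2⟩, h3⟩
        refine ⟨h1 c hcX', fun a ha _ => ?_, (reachable_iff_exists_mem_openEdgeCluster ω k o).1 h2, h3⟩
        rw [← reachable_iff_exists_mem_openEdgeCluster]; exact h1 a ha
      · rintro ⟨h1, h2, h3, h4⟩
        refine ⟨⟨fun a ha => ?_, (reachable_iff_exists_mem_openEdgeCluster ω k o).2 h3⟩, h4⟩
        by_cases hac : a = c
        · rw [hac]; exact h1
        · rw [reachable_iff_exists_mem_openEdgeCluster]; exact h2 a ha hac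
    have hDk_0 : Dk = {ω : BondConfig (Fin n) | ¬ (openGraph ω).Reachable k c} ∩
          {ω | openEdgeCluster ω k ∈ {K : Set (Sym2 (Fin n)) | ∀ a ∈ X', a ≠ c → ¬ (a = k ∨ ∃ e ∈ K, a ∈ e)}} := by
      ext ω
      simp only [mem_inter_iff, hDk, mem_setOf_eq, Finset.mem_coe]
      constructor
      · intro h1
        refine ⟨h1 c hcX', fun a ha _ => ?_⟩
        rw [← reachable_iff_exists_mem_openEdgeCluster]; exact h1 a ha
      · rintro ⟨h1, h2⟩ a ha
        by_cases hac : a = c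
        · rw [hac]; exact h1
        · rw [reachable_iff_exists_mem_openEdgeCluster]; exact h2 a ha hac
    have towO : Tko = ∫ ω in (Dk ∩ openConn k o) ∩ Hk, Gk (openEdgeCluster ω k) ∂μ := by
      simp only [hTko, hgk]; rw [hDk_S]; exact CovTau.setIntegral_sub_eq_projFun w c k F _
    have tow0 : J = ∫ ω in Dk, Gk (openEdgeCluster ω k) ∂μ := by
      simp only [hJ, hgk]; rw [hDk_0]; exact CovTau.setIntegral_sub_eq_projFun w c k F _
    have hJtot : J = ((∫ ω, F (openCluster ω k) ∂μ) - ∫ ω, F (openCluster ω c) ∂μ) - Δk := by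
      have h1 := integral_add_compl (hmeas Dk) (hint gk)
      have hDkc : Dkᶜ = ⋃ a' ∈ X', (openConn k a' : Set (BondConfig (Fin n))) := by
        ext ω
        rw [mem_iUnion_openConn, mem_compl_iff, hDk]
        simp only [mem_setOf_eq, Finset.mem_coe, not_forall, not_not, exists_prop]
      have h2 : ∫ ω in Dkᶜ, gk ω ∂μ = Δk := by rw [hDkc]
      have h3 : ∫ ω, gk ω ∂μ = (∫ ω, F (openCluster ω k) ∂μ) - ∫ ω, F (openCluster ω c) ∂μ := by
        rw [hgk, integral_sub (hint _) (hint _)]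
      rw [hJ]; linarith
    -- one-cluster positive association for `C_k` given `k ↮ X'`, with the monotone indicator of the pinned test
    set 𝒰 : Set (Set (Sym2 (Fin n))) := connFamily k o ∩ 𝓗 with h𝒰
    have h𝒰_upper : IsUpperSet 𝒰 := (isUpperSet_connFamily k o).inter h𝓗
    have hG : Monotone (𝒰.indicator (1 : Set (Sym2 (Fin n)) → ℝ)) := monotone_indicator_one_of_isUpperSet h𝒰_upper
    have hPA := BHK2006_clusterConditionalPositiveAssociation_holds (Fin n) w k (↑X' : Set (Fin n)) Gk
      (𝒰.indicator 1) hGk_mono hG (by exact_mod_cast hkX')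
    have hset : {ω : BondConfig (Fin n) | openEdgeCluster ω k ∈ 𝒰} = openConn k o ∩ Hk := by
      ext ω
      simp only [h𝒰, mem_setOf_eq, mem_inter_iff, hHk]
      rw [openConn_eq_setOf_connFamily]
      rfl
    have hind : (fun ω : BondConfig (Fin n) => 𝒰.indicator (1 : Set (Sym2 (Fin n)) → ℝ) (openEdgeCluster ω k)) =
        (openConn k o ∩ Hk : Set (BondConfig (Fin n))).indicator 1 := by
      rw [indicator_comp_openEdgeCluster 𝒰 k, hset]
    have hI1 : ∫ ω in Dk, 𝒰.indicator (1 : Set (Sym2 (Fin n)) → ℝ) (openEdgeCluster ω k) ∂μ = E := by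
      rw [show (fun ω => 𝒰.indicator (1 : Set (Sym2 (Fin n)) → ℝ) (openEdgeCluster ω k)) =
        (openConn k o ∩ Hk : Set (BondConfig (Fin n))).indicator 1 from hind, setIntegral_indicator_one_eq, hE,
        inter_assoc]
    have hI2 : ∫ ω in Dk, Gk (openEdgeCluster ω k) * 𝒰.indicator (1 : Set (Sym2 (Fin n)) → ℝ) (openEdgeCluster ω k) ∂μ =
        ∫ ω in (Dk ∩ openConn k o) ∩ Hk, Gk (openEdgeCluster ω k) ∂μ := by
      have e : ∀ ω : BondConfig (Fin n), Gk (openEdgeCluster ω k) *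
          𝒰.indicator (1 : Set (Sym2 (Fin n)) → ℝ) (openEdgeCluster ω k) =
          Gk (openEdgeCluster ω k) * (openConn k o ∩ Hk : Set (BondConfig (Fin n))).indicator (1 : BondConfig (Fin n) → ℝ) ω :=
        fun ω => congrArg (fun t => Gk (openEdgeCluster ω k) * t) (congrFun hind ω)
      simp_rw [e]
      rw [setIntegral_mul_indicator_one μ Dk (openConn k o ∩ Hk) _, inter_assoc]
    have hC : J * E ≤ M * Tko := by
      have h := hPA
      rw [hI1, hI2, ← tow0, ← towO] at h
      rw [hM]
      linarith [h]
    -- the refined two-observer margin from the pinned hierarchy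
    have hpm' : E * Δk ≤ M * Δo := by
      have h := twoObserver_of_pin w hw o 𝓗 hPin F hF k c X' hko hoX' hkX' hcX' (fun a ha => hcmin a (hXA (hX'X a ha)))
      rw [hE, hΔk, hM, hΔo]
      exact h
    have hE0 : 0 ≤ E := measureReal_nonneg
    have hmk' : 0 ≤ (∫ ω, F (openCluster ω k) ∂μ) - ∫ ω, F (openCluster ω c) ∂μ := by linarith [hmk]
    have hfin : 0 ≤ M * (Δo + Tko) := by
      have hJE : J * E = ((∫ ω, F (openCluster ω k) ∂μ) - ∫ ω, F (openCluster ω c) ∂μ) * E - Δk * E := by rw [hJtot]; ring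
      nlinarith [hC, hpm', hJE, mul_nonneg hmk' hE0]
    rw [hpeel]
    have hMpos : 0 < M := by
      refine prodBernoulli_real_pos_of_nonempty hw ⟨∅, ?_⟩
      intro a ha h
      rw [HullPort.reachable_empty_iff] at h
      exact hkX' (h ▸ (Finset.mem_coe.1 ha))
    exact le_of_mul_le_mul_left (by rw [mul_zero]; exact hfin) hMpos
  exact main A (subset_refl A) hcA

/-- **The event-refined Conjecture 4 (designated form) for EVERY relay set and EVERY increasing cluster event, from the pinned
hierarchy**: for `A ≠ ∅`, `o`, `E = {C_o ∈ 𝓗}` (`𝓗` upper) and monotone `F`, some `a ∈ A` (any relay of least mean, or `o` itself if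
`o ∈ A`) has `∫_{E ∩ {o↔A}} F(C a) ≤ ∫_{E ∩ {o↔A}} F(C o)`.  `𝓗 = univ`: the tree's `PreFKGSurplus.kn_conj4_of_csh`.
[cite: KozmaNitzan2024, Conj. 4 (p. 32)] -/
theorem conj4_refined_of_pin (w : Sym2 (Fin n) → unitInterval) (hw : ∀ e, 0 < w e ∧ w e < 1) (o : Fin n)
    (𝓗 : Set (Set (Sym2 (Fin n)))) (h𝓗 : IsUpperSet 𝓗)
    (hPin : ∀ (v x : Fin n) (Y : Finset (Fin n)) (D : List (Fin n)),
      o ≠ v → x ∉ Y → o ≠ x → v ≠ x → o ∉ Y → v ∉ Y → D.Nodup → (∀ d ∈ D, d ≠ x ∧ d ∉ Y ∧ d ≠ o ∧ d ≠ v) →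
      Holds w o 𝓗 x (↑Y : Set (Fin n)) D v)
    (F : Set (Fin n) → ℝ) (hF : ∀ S T : Set (Fin n), S ⊆ T → F S ≤ F T) (A : Finset (Fin n)) (hA : A.Nonempty) :
    ∃ a ∈ A, ∫ ω in {ω : BondConfig (Fin n) | openEdgeCluster ω o ∈ 𝓗} ∩ ⋃ a' ∈ A, openConn o a',
        F (openCluster ω a) ∂(prodBernoulli w) ≤
      ∫ ω in {ω : BondConfig (Fin n) | openEdgeCluster ω o ∈ 𝓗} ∩ ⋃ a' ∈ A, openConn o a',
        F (openCluster ω o) ∂(prodBernoulli w) := by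
  classical
  have hint : ∀ (g : BondConfig (Fin n) → ℝ), Integrable g (prodBernoulli w) := fun g => Integrable.of_finite
  by_cases hoA : o ∈ A
  · exact ⟨o, hoA, le_rfl⟩
  obtain ⟨c, hcA, hcmin⟩ := Finset.exists_min_image A (fun u => ∫ ω, F (openCluster ω u) ∂(prodBernoulli w)) hA
  refine ⟨c, hcA, ?_⟩
  have hΔ := refined_margin_nonneg_of_pin w hw o 𝓗 h𝓗 hPin F hF A c hoA hcA hcmin
  rw [integral_sub (hint _).integrableOn (hint _).integrableOn] at hΔ
  linarith

/-- **Question 7 / (41) refined by an increasing cluster event, from the pinned hierarchy** (`F = 1{b ∈ ·}`; the line's UT4 / QUT4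
(`δ ≤ 0`) for EVERY number of ports when `o` is a star and `𝓗` a pattern up-set of its edges, QS with spectator edges, and the
general-observer form of FINDINGS-gen13 §5): for `E = {C_o ∈ 𝓗}`, `o ∉ A`, and `c ∈ A` with `μ(c ↔ b) ≤ μ(a ↔ b)` for all `a ∈ A`,
`μ({c ↔ b} ∩ E ∩ {o ↔ A}) ≤ μ({o ↔ b} ∩ E ∩ {o ↔ A})`. [cite: KozmaNitzan2024, Question 7 (p. 36), (41) (p. 33)] -/
theorem question7_refined_of_pin (w : Sym2 (Fin n) → unitInterval) (hw : ∀ e, 0 < w e ∧ w e < 1) (o : Fin n)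
    (𝓗 : Set (Set (Sym2 (Fin n)))) (h𝓗 : IsUpperSet 𝓗)
    (hPin : ∀ (v x : Fin n) (Y : Finset (Fin n)) (D : List (Fin n)),
      o ≠ v → x ∉ Y → o ≠ x → v ≠ x → o ∉ Y → v ∉ Y → D.Nodup → (∀ d ∈ D, d ≠ x ∧ d ∉ Y ∧ d ≠ o ∧ d ≠ v) →
      Holds w o 𝓗 x (↑Y : Set (Fin n)) D v)
    (b : Fin n) (A : Finset (Fin n)) (c : Fin n) (hoA : o ∉ A) (hcA : c ∈ A)
    (hcmin : ∀ a ∈ A, (prodBernoulli w).real (openConn c b) ≤ (prodBernoulli w).real (openConn a b)) :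
    (prodBernoulli w).real
        (openConn c b ∩ ({ω : BondConfig (Fin n) | openEdgeCluster ω o ∈ 𝓗} ∩ ⋃ a ∈ A, openConn o a)) ≤
      (prodBernoulli w).real
        (openConn o b ∩ ({ω : BondConfig (Fin n) | openEdgeCluster ω o ∈ 𝓗} ∩ ⋃ a ∈ A, openConn o a)) := by
  classical
  set μ := prodBernoulli w with hμ
  set F : Set (Fin n) → ℝ := fun S => if b ∈ S then (1 : ℝ) else 0 with hFdef
  have hF : ∀ S T : Set (Fin n), S ⊆ T → F S ≤ F T := by
    intro S T hST
    by_cases hb : b ∈ S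
    · simp [hFdef, hb, hST hb]
    · by_cases hb' : b ∈ T <;> simp [hFdef, hb, hb']
  have hI : ∀ (x : Fin n) (S : Set (BondConfig (Fin n))), ∫ ω in S, F (openCluster ω x) ∂μ = μ.real (openConn x b ∩ S) := by
    intro x S
    have hfun : (fun ω : BondConfig (Fin n) => F (openCluster ω x)) = (openConn x b : Set (BondConfig (Fin n))).indicator 1 := by
      funext ω
      by_cases h : (openGraph ω).Reachable x b
      · have hb : b ∈ openCluster ω x := h
        have hω : ω ∈ (openConn x b : Set (BondConfig (Fin n))) := h
        rw [indicator_of_mem hω]; simp [hFdef, hb]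
      · have hb : b ∉ openCluster ω x := h
        have hω : ω ∉ (openConn x b : Set (BondConfig (Fin n))) := h
        rw [indicator_of_notMem hω]; simp [hFdef, hb]
    rw [hfun, setIntegral_indicator_one_eq, inter_comm]
  have hI0 : ∀ x : Fin n, ∫ ω, F (openCluster ω x) ∂μ = μ.real (openConn x b) := by
    intro x
    have h := hI x univ
    rwa [Measure.restrict_univ, inter_univ] at h
  have hcmin' : ∀ a ∈ A, ∫ ω, F (openCluster ω c) ∂μ ≤ ∫ ω, F (openCluster ω a) ∂μ := by
    intro a ha; rw [hI0, hI0]; exact hcmin a ha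
  have hΔ := refined_margin_nonneg_of_pin w hw o 𝓗 h𝓗 hPin F hF A c hoA hcA hcmin'
  rw [integral_sub (Integrable.of_finite).integrableOn (Integrable.of_finite).integrableOn, hI, hI] at hΔ
  linarith

/-- **Vertex-cluster events** (the general-observer form of FINDINGS-gen13 §5: `E = {C(o) ∈ 𝓗_V}` for an upper family `𝓗_V` of VERTEX
sets, e.g. `{|C(o) ∩ B| ≥ 2}`): the event-refined Conjecture 4 for every relay set from the pinned hierarchy of the induced edge family
`{K | span_o K ∈ 𝓗_V}` — the conclusion of gen 13's `RefinedPreFKG.conj4_refined_of_twoObserver` with its hypothesis (II)_𝓗 discharged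
from `hPin`. [cite: KozmaNitzan2024, Conj. 4 (p. 32)] -/
theorem conj4_refinedVertex_of_pin (w : Sym2 (Fin n) → unitInterval) (hw : ∀ e, 0 < w e ∧ w e < 1) (o : Fin n)
    (𝓥 : Set (Set (Fin n))) (h𝓥 : IsUpperSet 𝓥)
    (hPin : ∀ (v x : Fin n) (Y : Finset (Fin n)) (D : List (Fin n)),
      o ≠ v → x ∉ Y → o ≠ x → v ≠ x → o ∉ Y → v ∉ Y → D.Nodup → (∀ d ∈ D, d ≠ x ∧ d ∉ Y ∧ d ≠ o ∧ d ≠ v) →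
      Holds w o {K : Set (Sym2 (Fin n)) | {z : Fin n | z = o ∨ ∃ e ∈ K, z ∈ e} ∈ 𝓥} x (↑Y : Set (Fin n)) D v)
    (F : Set (Fin n) → ℝ) (hF : ∀ S T : Set (Fin n), S ⊆ T → F S ≤ F T) (A : Finset (Fin n)) (hA : A.Nonempty) :
    ∃ a ∈ A, ∫ ω in {ω : BondConfig (Fin n) | openCluster ω o ∈ 𝓥} ∩ ⋃ a' ∈ A, openConn o a',
        F (openCluster ω a) ∂(prodBernoulli w) ≤
      ∫ ω in {ω : BondConfig (Fin n) | openCluster ω o ∈ 𝓥} ∩ ⋃ a' ∈ A, openConn o a',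
        F (openCluster ω o) ∂(prodBernoulli w) := by
  classical
  set 𝓗 : Set (Set (Sym2 (Fin n))) := {K : Set (Sym2 (Fin n)) | {z : Fin n | z = o ∨ ∃ e ∈ K, z ∈ e} ∈ 𝓥} with h𝓗def
  have h𝓗 : IsUpperSet 𝓗 := by
    intro K K' hKK' hK
    refine h𝓥 ?_ hK
    intro z hz
    rcases hz with h | ⟨e, he, hze⟩
    · exact Or.inl h
    · exact Or.inr ⟨e, hKK' he, hze⟩
  have hev : {ω : BondConfig (Fin n) | openEdgeCluster ω o ∈ 𝓗} = {ω : BondConfig (Fin n) | openCluster ω o ∈ 𝓥} := by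
    ext ω
    have hspan : openCluster ω o = {z : Fin n | z = o ∨ ∃ e ∈ openEdgeCluster ω o, z ∈ e} := by
      ext z; exact reachable_iff_exists_mem_openEdgeCluster ω o z
    simp only [h𝓗def, mem_setOf_eq, hspan]
  have h := conj4_refined_of_pin w hw o 𝓗 h𝓗 hPin F hF A hA
  rw [hev] at h
  exact h

end PinCSH

end Summit.CriticalPhenomena.PercolationContinuityZ3.Theorems
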